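import Summits.Ventures.CertifiedManyBodySolver.Rows.SourcedTorusRowsOnePointKKT
import HarnessLib

/-!
# PINNING-FIELD rows: KKT one-point certificates INSIDE AN ENERGY WINDOW are response leaves
# (q-slotted energy CEILING rows)

HONEST FRAMING: first certified bounds on pairing observables; not a superconductivity verdict; every
number certified (two lineages + referee) or labelled float. A response AT FIXED `h > 0` is
symmetry-allowed and says nothing about spontaneous order.

WHAT THIS FILE IS (cell hubbard-cq, D-0082 (c) / LADDER row PC-a, seat hubbard-cq-obsth-1 "pinning-field K5
menu nodes"; sequel of `Rows/SourcedTorusRowsOnePointKKT.lean`). The live regime of the instrument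
`sourced-kkt-one-point-floor` is «KKT rows + ENERGY WINDOW» (critic-1 §9.5 / verdict c1 (C)): the one-point MIN
program for `Re ω(Φ₀ + Φ₀ᴴ)` carries, besides SOS, commutators with `H^{src,tt'}_{Λ'}`, affine-`D₄` defects over
`S ∋ 1` closed under products with `χ_{B₁g} = 1`, `S^z`-charged words, anti-Hermitian parts, residual words and the
KKT block `kktForm H^{src,tt'}_{Λ'} G (Γ(incl) ∘ B)` (`G ⪰ 0`, ARBITRARY `B_b ∈ 𝔄_Λ`), ONE energy term
`κ (u·1 − E^{src,tt'})` with `κ ≥ 0` and a rational cap `u` — and the cap is DISCHARGED by a q-SLOTTED energy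
ceiling row `SourcedEnergyUpperRow tp U μ h q L₀ u` (`E₀(A_L) ≤ u·L²` for `L ≥ L₀`, `q ∣ L`: the open-cluster /
open-box product-state caps of `Upper/DWaveSourceOpenClusterCap[TTPrime]`, `12 ∣ L`, `16 ∣ L`, `32 ∣ L`, …).
Output: `∃ L₀', PinFieldResponseFloorAt tp U μ h q L₀' (r/2)` for every slot `r ≤ c − Σₖ ‖aₖ‖`
(`pinFieldResponseFloorAt_of_onePoint_window_certificate_kkt_of_energyUpperRow`: `Rows/SourcedTorusRowsKKTHook`
uniform ground-state cell given the ceiling cell ⇒ `Rows/SourcedTorusRowsOnePointD4` canonical cell ⇒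
`Rows/SourcedTorusRowsDensityBridge` leaf), and the MAX program's CEILING leaf
(`pinFieldResponseCeilingAt_of_onePoint_window_certificate_kkt_of_energyUpperRow`). In words: «program value `v`
for `Re ω(Φ₀ + Φ₀ᴴ)` under KKT rows and the window `ω(E^{src,tt'}) ≤ u` ⇒ `m_L(h) ≥ v/2` on every torus side
`L ≥ L₀'` with `q ∣ L` on which the cap `u` is certified». The all-`L` (no `q`) reader of the same identity straight
into `dWaveSourceDensityTT'` is `Literature/…/DWaveSourceOnePointWindowCertificate`
(`dWaveSourceDensityTT'_ge_of_window_certificate_kkt_d4_eventually`, seat p6); this file is its q-slotted twin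
through the cells. The TWO-SIDED window (an imported energy FLOOR row as well) is in
`Rows/SourcedTorusRowsKKTEnergyWindowHook.lean`.

NOTHING IS ASSERTED: identities and rows in, leaves out; no certificate, no number, no `sorry`, no named fact.
No definition.

References: T. Koma, H. Tasaki, J. Stat. Phys. 76 (1994) 745, §1; J. Wang et al., PRX 14 (2024) 031006, §III
(energy constraints as rows); M. Araújo et al., arXiv:2311.18707 §3.2 Prop. 11; O. Bratteli, D. W. Robinson II
Prop. 5.3.19, §6.2.4.
-/

noncomputable section

namespace Summit.Ventures.CertifiedManyBodySolver

open Literature.MathematicalPhysics.QuantumLattice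
open Matrix HubbardWave0 Literature.Probability.LatticeModels Finset
open Literature.MathematicalPhysics.QuantumManyBody.StateRelaxation
open Summit.Ventures.CertifiedManyBodySolver.Observables
open scoped BigOperators ComplexOrder

/-! ## §1  KKT one-point certificate + q-slotted energy CEILING row ⇒ response FLOOR / CEILING leaf -/

section EnergyUpperRow

/-- **A KKT one-point window certificate INSIDE AN ENERGY WINDOW is, end to end, a response FLOOR leaf.**
The identity of `re_orbitState_ge_of_sourced_window_certificate_d4_TT'_kkt_of_energy_le` for the objective
`Γ(incl)(Φ₀ + Φ₀ᴴ)` — SOS, commutators with `H^{src,tt'}_{Λ'}`, affine-`D₄` defects over `S ∋ 1` closed under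
products with `χ_{B₁g} = 1`, `S^z`-charged words, anti-Hermitian parts, residual words, the KKT block
`kktForm H^{src,tt'}_{Λ'} G (Γ(incl) ∘ B)` with `G ⪰ 0` and ARBITRARY generators, and the energy term
`κ (u·1 − E^{src,tt'})` with `κ ≥ 0` — together with the q-slotted energy CEILING row
`SourcedEnergyUpperRow tp U μ h q L₀ u` and a rational slot `r ≤ c − Σₖ ‖aₖ‖` give
`∃ L₀', PinFieldResponseFloorAt tp U μ h q L₀' (r/2)`: `r/2 ≤ m_L(h) = dWaveSourceDensityTT' L tp U μ h` on every
side `L ≥ L₀'` with `q ∣ L` (readers `PinFieldResponseFloorAt.le_liminf`, `.le_pinningFieldPairingOrder`).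
[cite: KomaTasaki1994, §1] [cite: WangEtAl2024, §III] -/
theorem pinFieldResponseFloorAt_of_onePoint_window_certificate_kkt_of_energyUpperRow (tp U μ h : ℝ)
    {u r : ℚ} {q L₀ : ℕ} (hE : SourcedEnergyUpperRow tp U μ h q L₀ u)
    {Λ Λ' : Finset (Site 2)} (hΛ : Λ ⊆ Λ') (h8 : thicken Λ 1 ⊆ Λ')
    (h0 : thicken ({0} : Finset (Site 2)) 1 ⊆ Λ') (hz : (0 : Site 2) ∈ Λ')
    (hP : pairRegion (insert (0 : Site 2) unitSteps) 0 ⊆ Λ')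
    {S : Finset (DihedralGroup 4)} (h1 : (1 : DihedralGroup 4) ∈ S) (hmul : ∀ a ∈ S, ∀ b ∈ S, a * b ∈ S)
    (hS : ∀ γ ∈ S, b1gChar γ = 1) {κ : ℝ} (hκ : 0 ≤ κ)
    {m : Type*} [Fintype m] [DecidableEq m] {Λm : Matrix m m ℂ} (hΛm : Λm.PosSemidef)
    (O : m → FermionOp Λ')
    {κ' : Type*} (s : Finset κ') (B : κ' → FermionOp Λ)
    {ι : Type*} (tt : Finset ι) (γ : ι → DihedralGroup 4) (hγS : ∀ l ∈ tt, γ l ∈ S) (wv : ι → Site 2)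
    (hsh : ∀ l, d4ShiftSet (γ l) (wv l) Λ ⊆ Λ') (Y : ι → FermionOp Λ)
    {ρ : Type*} (uu : Finset ρ) (b : ρ → ℂ) (cw : ρ → List (Orb (PolySite Λ') × Bool))
    (hcw : ∀ j ∈ uu, ladderSpinCharge (cw j) ≠ 0)
    {δ : Type*} (ah : Finset δ) (dc : δ → ℝ) (V : δ → FermionOp Λ')
    {κ'' : Type*} (w : Finset κ'') (a : κ'' → ℂ) (word : κ'' → List (Orb (PolySite Λ') × Bool))
    {β : Type*} [Fintype β] [DecidableEq β] {G : Matrix β β ℂ} (hG : G.PosSemidef)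
    (Bk : β → FermionOp Λ) {c : ℝ}
    (hcert : fermionEmbed (PolySite.incl hP) onePointPairWord - (c : ℂ) • (1 : FermionOp Λ') -
        ((κ : ℝ) : ℂ) • ((((u : ℚ) : ℝ) : ℂ) • (1 : FermionOp Λ') -
          (fermionEmbed (PolySite.incl h0) ((hubbardTTPrimeFermionInteraction 1 tp U).meanEnergyObs 1) -
            (μ : ℂ) • ∑ σ : Fin 2, nAt 0 hz σ -
            (h : ℂ) • (fermionEmbed (PolySite.incl hP) (localPairAt (insert (0 : Site 2) unitSteps) dWaveFormFactor 0) +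
              (fermionEmbed (PolySite.incl hP) (localPairAt (insert (0 : Site 2) unitSteps) dWaveFormFactor 0))ᴴ))) =
      gramForm Λm O +
        (∑ k ∈ s, (pairSourceWindowHamiltonianTT' dWaveFormFactor Λ' tp U μ h * fermionEmbed (PolySite.incl hΛ) (B k) -
            fermionEmbed (PolySite.incl hΛ) (B k) * pairSourceWindowHamiltonianTT' dWaveFormFactor Λ' tp U μ h) +
          ∑ l ∈ tt, (fermionEmbed (PolySite.incl (hsh l)) (fermionEmbed (PolySite.d4Emb (γ l) (wv l) Λ) (Y l)) -
            fermionEmbed (PolySite.incl hΛ) (Y l)) +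
          ∑ j ∈ uu, b j • ladderWord (cw j)) +
        (∑ m' ∈ ah, ((dc m' : ℝ) : ℂ) • ((V m')ᴴ - V m') + ∑ k ∈ w, a k • ladderWord (word k)) +
        kktForm (pairSourceWindowHamiltonianTT' dWaveFormFactor Λ' tp U μ h) G
          (fun b' => fermionEmbed (PolySite.incl hΛ) (Bk b')))
    (hr : ((r : ℚ) : ℝ) ≤ c - ∑ k ∈ w, ‖a k‖) :
    ∃ L₀' : ℕ, PinFieldResponseFloorAt tp U μ h q L₀' (r / 2) := by
  obtain ⟨L₁, hL₁⟩ := SourcedCorrLowerRowGS.of_window_certificate_kkt_of_energyUpperRow tp U μ h hE hΛ h8 h0 hz hP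
    h1 hmul hS (fermionEmbed (PolySite.incl hP) onePointPairWord) hκ hΛm O s B tt γ hγS wv hsh Y uu b cw hcw ah dc V w
    a word hG Bk hcert hr
  obtain ⟨L₂, hL₂⟩ := hL₁.onePoint_canonical h1 hmul hS hP
  exact ⟨max L₂ 3, hL₂.pinFieldResponseFloorAt⟩

/-- **MAX program inside an energy window: a KKT one-point certificate for `−Γ(incl)(Φ₀ + Φ₀ᴴ)` with the energy
term `κ (u·1 − E^{src,tt'})`, `κ ≥ 0`, plus the q-slotted energy ceiling row at `u`, is a response CEILING leaf**
`∃ L₀', PinFieldResponseCeilingAt tp U μ h q L₀' (−r/2)` (`m_L(h) ≤ −r/2`) for `r ≤ c − Σₖ ‖aₖ‖`.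
[cite: KomaTasaki1994, §1] [cite: WangEtAl2024, §III] -/
theorem pinFieldResponseCeilingAt_of_onePoint_window_certificate_kkt_of_energyUpperRow (tp U μ h : ℝ)
    {u r : ℚ} {q L₀ : ℕ} (hE : SourcedEnergyUpperRow tp U μ h q L₀ u)
    {Λ Λ' : Finset (Site 2)} (hΛ : Λ ⊆ Λ') (h8 : thicken Λ 1 ⊆ Λ')
    (h0 : thicken ({0} : Finset (Site 2)) 1 ⊆ Λ') (hz : (0 : Site 2) ∈ Λ')
    (hP : pairRegion (insert (0 : Site 2) unitSteps) 0 ⊆ Λ')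
    {S : Finset (DihedralGroup 4)} (h1 : (1 : DihedralGroup 4) ∈ S) (hmul : ∀ a ∈ S, ∀ b ∈ S, a * b ∈ S)
    (hS : ∀ γ ∈ S, b1gChar γ = 1) {κ : ℝ} (hκ : 0 ≤ κ)
    {m : Type*} [Fintype m] [DecidableEq m] {Λm : Matrix m m ℂ} (hΛm : Λm.PosSemidef)
    (O : m → FermionOp Λ')
    {κ' : Type*} (s : Finset κ') (B : κ' → FermionOp Λ)
    {ι : Type*} (tt : Finset ι) (γ : ι → DihedralGroup 4) (hγS : ∀ l ∈ tt, γ l ∈ S) (wv : ι → Site 2)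
    (hsh : ∀ l, d4ShiftSet (γ l) (wv l) Λ ⊆ Λ') (Y : ι → FermionOp Λ)
    {ρ : Type*} (uu : Finset ρ) (b : ρ → ℂ) (cw : ρ → List (Orb (PolySite Λ') × Bool))
    (hcw : ∀ j ∈ uu, ladderSpinCharge (cw j) ≠ 0)
    {δ : Type*} (ah : Finset δ) (dc : δ → ℝ) (V : δ → FermionOp Λ')
    {κ'' : Type*} (w : Finset κ'') (a : κ'' → ℂ) (word : κ'' → List (Orb (PolySite Λ') × Bool))
    {β : Type*} [Fintype β] [DecidableEq β] {G : Matrix β β ℂ} (hG : G.PosSemidef)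
    (Bk : β → FermionOp Λ) {c : ℝ}
    (hcert : -fermionEmbed (PolySite.incl hP) onePointPairWord - (c : ℂ) • (1 : FermionOp Λ') -
        ((κ : ℝ) : ℂ) • ((((u : ℚ) : ℝ) : ℂ) • (1 : FermionOp Λ') -
          (fermionEmbed (PolySite.incl h0) ((hubbardTTPrimeFermionInteraction 1 tp U).meanEnergyObs 1) -
            (μ : ℂ) • ∑ σ : Fin 2, nAt 0 hz σ -
            (h : ℂ) • (fermionEmbed (PolySite.incl hP) (localPairAt (insert (0 : Site 2) unitSteps) dWaveFormFactor 0) +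
              (fermionEmbed (PolySite.incl hP) (localPairAt (insert (0 : Site 2) unitSteps) dWaveFormFactor 0))ᴴ))) =
      gramForm Λm O +
        (∑ k ∈ s, (pairSourceWindowHamiltonianTT' dWaveFormFactor Λ' tp U μ h * fermionEmbed (PolySite.incl hΛ) (B k) -
            fermionEmbed (PolySite.incl hΛ) (B k) * pairSourceWindowHamiltonianTT' dWaveFormFactor Λ' tp U μ h) +
          ∑ l ∈ tt, (fermionEmbed (PolySite.incl (hsh l)) (fermionEmbed (PolySite.d4Emb (γ l) (wv l) Λ) (Y l)) -
            fermionEmbed (PolySite.incl hΛ) (Y l)) +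
          ∑ j ∈ uu, b j • ladderWord (cw j)) +
        (∑ m' ∈ ah, ((dc m' : ℝ) : ℂ) • ((V m')ᴴ - V m') + ∑ k ∈ w, a k • ladderWord (word k)) +
        kktForm (pairSourceWindowHamiltonianTT' dWaveFormFactor Λ' tp U μ h) G
          (fun b' => fermionEmbed (PolySite.incl hΛ) (Bk b')))
    (hr : ((r : ℚ) : ℝ) ≤ c - ∑ k ∈ w, ‖a k‖) :
    ∃ L₀' : ℕ, PinFieldResponseCeilingAt tp U μ h q L₀' (-r / 2) := by
  obtain ⟨L₁, hL₁⟩ := SourcedCorrLowerRowGS.of_window_certificate_kkt_of_energyUpperRow tp U μ h hE hΛ h8 h0 hz hP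
    h1 hmul hS (-fermionEmbed (PolySite.incl hP) onePointPairWord) hκ hΛm O s B tt γ hγS wv hsh Y uu b cw hcw ah dc V w
    a word hG Bk hcert hr
  have hup : SourcedCorrUpperRowGS tp U μ h q L₁ (-r) Λ' S (fermionEmbed (PolySite.incl hP) onePointPairWord) :=
    fun L _ hInj' hL hqL => SourcedTorusCorrUpperRowGS.of_lower_neg (by rw [neg_neg]; exact hL₁ L hInj' hL hqL)
  obtain ⟨L₂, hL₂⟩ := hup.onePoint_canonical h1 hmul hS hP
  exact ⟨max L₂ 3, hL₂.pinFieldResponseCeilingAt⟩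

end EnergyUpperRow

end Summit.Ventures.CertifiedManyBodySolver

end
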